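import Summits.NavierStokesRegularity.FunctionalMining.StretchingLowerCellularIntegrals
import Summits.NavierStokesRegularity.FunctionalMining.StretchingWrapIdentity
import HarnessLib

/-!
# K1-Q1, the wrap identity bound (bank blueprint N1) — part 1: the diagonal crossed-shear flow

Cell `pub-nsfunc` (host summit NavierStokesRegularity, topic `FunctionalMining`), prove seat gen 5, kernel proof of
node **N1 `WrapIdentityBound`** of the bank seat's `WRAP-KERNEL-BLUEPRINT.md` §2, as typed by the dictionary seat in
`StretchingWrapIdentity.lean` (three files `StretchingWrapFlow`, `StretchingWrapCases`, `StretchingWrapIdentityHolds`).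
**Search for candidate a priori estimates; no regularity claim.** Static field facts only;
nothing is asserted about Navier–Stokes solutions or their regularity.

This part: functions `P(n₁x₁ + n₂x₂)` on `T³` (smoothness, `∂_j = n_j P'`), the wrap profile
`Q̃ = S_ε(· + 2ε − ¼)` (slope `Q̃' = +1` on the arc `[0, ½ − 2ε]`, `−1` on `[½, 1 − 2ε]`, hence `+1` on `inArc 2δ` and
`−1` on its half-translate when `ε ≤ δ`; `∫₀¹Q̃' = 0`, `∫₀¹Q̃'² ≤ 1`), and the diagonal crossed-shear flow
`V₂ = κQ̃(x₁+x₂)·(0,1,−1) + κQ̃(x₁−x₂)·(0,1,1)`: smooth, divergence free, with gradient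
`κ[[0,0,0],[0,a+b,a−b],[0,b−a,−a−b]]` (`a = Q̃'(x₁+x₂)`, `b = Q̃'(x₁−x₂)`), i.e. strain `κ(a+b)·diag(0,1,−1)` and
vorticity `2κ(b−a)e₀`.
-/

noncomputable section

open MeasureTheory Set Filter Topology Function
open scoped InnerProductSpace ContDiff

namespace Summit.NavierStokesRegularity.FunctionalMining

open Literature.Analysis Literature.Analysis.FunctionSpaces Literature.Analysis.FunctionSpaces.Torus
open Literature.Analysis.FluidPDE Literature.Analysis.FluidPDE.Torus

namespace WrapStretching

open CellularStretching

/-! ## 1. Functions `P(n₁x₁ + n₂x₂)` on `T³` -/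

/-- `x ↦ P(n₁x₁ + n₂x₂)` on `T³` (the neutral coordinate `x₀` does not enter). [ours; bookkeeping] -/
def diagForm (n₁ n₂ : ℤ) (P : ShearProfile) (x : UnitAddTorus (Fin 3)) : ℝ :=
  P.onCircle (n₁ • x 1 + n₂ • x 2)

/-- Values on the covering space. [folklore] -/
theorem diagForm_proj (n₁ n₂ : ℤ) (P : ShearProfile) (z : EuclideanSpace ℝ (Fin 3)) :
    diagForm n₁ n₂ P (proj z) = P (n₁ * z 1 + n₂ * z 2) := by
  rw [diagForm, proj_apply, proj_apply, ← AddCircle.coe_zsmul, ← AddCircle.coe_zsmul, ← AddCircle.coe_add,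
    ShearProfile.onCircle_coe, zsmul_eq_mul, zsmul_eq_mul]

/-- `diagForm 1 1 P x = P(x₁ + x₂)`. [folklore] -/
@[simp] theorem diagForm_one_one (P : ShearProfile) (x : UnitAddTorus (Fin 3)) :
    diagForm 1 1 P x = P.onCircle (x 1 + x 2) := by simp [diagForm]

/-- `diagForm 1 (−1) P x = P(x₁ − x₂)`. [folklore] -/
@[simp] theorem diagForm_one_neg_one (P : ShearProfile) (x : UnitAddTorus (Fin 3)) :
    diagForm 1 (-1) P x = P.onCircle (x 1 - x 2) := by simp [diagForm, sub_eq_add_neg]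

/-- `x ↦ P(n₁x₁ + n₂x₂)` is smooth. [folklore] -/
theorem isSmooth_diagForm (n₁ n₂ : ℤ) (P : ShearProfile) : IsSmooth (diagForm n₁ n₂ P) := by
  unfold IsSmooth lift
  have : (diagForm n₁ n₂ P ∘ proj) = fun z : EuclideanSpace ℝ (Fin 3) => P (n₁ * z 1 + n₂ * z 2) := by
    funext z; exact diagForm_proj n₁ n₂ P z
  rw [this]
  exact P.contDiff.comp
    ((contDiff_const.mul (EuclideanSpace.proj (1 : Fin 3) : EuclideanSpace ℝ (Fin 3) →L[ℝ] ℝ).contDiff).add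
      (contDiff_const.mul (EuclideanSpace.proj (2 : Fin 3) : EuclideanSpace ℝ (Fin 3) →L[ℝ] ℝ).contDiff))

/-- `C¹` bookkeeping. [folklore] -/
theorem isContDiff_diagForm (n₁ n₂ : ℤ) (P : ShearProfile) : IsContDiff 1 (diagForm n₁ n₂ P) :=
  (isSmooth_diagForm n₁ n₂ P).isContDiff (by simp)

/-- Continuity bookkeeping: `x ↦ P(x₁ + x₂)` on `T³`. [folklore] -/
theorem continuous_onCircle_add₃ (P : ShearProfile) :
    Continuous fun x : UnitAddTorus (Fin 3) => P.onCircle (x 1 + x 2) := by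
  simp only [← diagForm_one_one]; exact (isSmooth_diagForm 1 1 P).continuous

/-- Continuity bookkeeping: `x ↦ P(x₁ − x₂)` on `T³`. [folklore] -/
theorem continuous_onCircle_sub₃ (P : ShearProfile) :
    Continuous fun x : UnitAddTorus (Fin 3) => P.onCircle (x 1 - x 2) := by
  simp only [← diagForm_one_neg_one]; exact (isSmooth_diagForm 1 (-1) P).continuous

/-- The coefficient `n_j` of `x_j` in `n₁x₁ + n₂x₂` (`n₀ = 0`). [ours; bookkeeping] -/
def diagCoeff (n₁ n₂ : ℤ) (j : Fin 3) : ℝ := if j = 1 then (n₁ : ℝ) else if j = 2 then (n₂ : ℝ) else 0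

/-- **Partial derivatives of `P(n₁x₁ + n₂x₂)`**: `∂_j = n_j · P'(n₁x₁ + n₂x₂)`. [folklore] -/
theorem partialDeriv_diagForm (n₁ n₂ : ℤ) (P : ShearProfile) (j : Fin 3) (x : UnitAddTorus (Fin 3)) :
    Torus.partialDeriv j (diagForm n₁ n₂ P) x = diagCoeff n₁ n₂ j * diagForm n₁ n₂ P.D x := by
  obtain ⟨z, rfl⟩ := proj_surjective x
  unfold Torus.partialDeriv Torus.lineDeriv
  have harg : ∀ t : ℝ, proj z + proj (t • EuclideanSpace.single j (1 : ℝ)) =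
      proj (z + t • EuclideanSpace.single j 1) := fun t => (proj_add _ _).symm
  simp_rw [harg, diagForm_proj, ShearProfile.D_apply]
  have hfun : (fun t : ℝ => P (n₁ * (z + t • EuclideanSpace.single j (1 : ℝ)) 1 +
      n₂ * (z + t • EuclideanSpace.single j (1 : ℝ)) 2)) =
      fun t => P ((n₁ * z 1 + n₂ * z 2) + t * diagCoeff n₁ n₂ j) := by
    funext t
    congr 1
    fin_cases j <;> simp [diagCoeff] <;> ring
  rw [hfun, deriv_comp_affine]

/-! ## 2. The wrap profile `Q̃ = S_ε(· + 2ε − ¼)` -/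

section Profile

variable {ε : ℝ} (hε : 0 < ε) (hε' : ε ≤ 1 / 32)

/-- **The wrap profile** `Q̃(t) = S_ε(t + 2ε − ¼)`: `Q̃' = w_ε(· + 2ε − ¼)` is `+1` on `[0, ½ − 2ε]` and `−1` on
`[½, 1 − 2ε]`. [ours] -/
def wprof (hε : 0 < ε) (hε' : ε ≤ 1 / 32) : ShearProfile := shift (base hε hε') (2 * ε - 4⁻¹)

/-- `Q̃'(t) = w_ε(t + 2ε − ¼)`. [folklore] -/
theorem deriv_wprof (t : ℝ) : deriv (wprof hε hε') t = DEIJ.slopeWave ε (t + (2 * ε - 4⁻¹)) := by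
  rw [wprof, deriv_shift, deriv_base]

/-- `|Q̃'| ≤ 1`. [folklore] -/
theorem abs_deriv_wprof_le (t : ℝ) : |deriv (wprof hε hε') t| ≤ 1 := by
  rw [deriv_wprof]; exact DEIJ.abs_slopeWave_le hε (le_sixteenth hε') _

/-- `|Q̃'| ≤ 1` on the circle. [folklore] -/
theorem abs_wprofD_le (b : UnitAddCircle) : |(wprof hε hε').D.onCircle b| ≤ 1 :=
  abs_D_onCircle_le (abs_deriv_wprof_le hε hε') b

/-- **Plateau `+1`**: `Q̃' = 1` at `↑t` for `t ∈ [0, ½ − 2ε]`. [ours; elementary] -/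
theorem wprofD_eq_one {t : ℝ} (ht : t ∈ Icc (0 : ℝ) (1 / 2 - 2 * ε)) :
    (wprof hε hε').D.onCircle (t : UnitAddCircle) = 1 := by
  rw [ShearProfile.onCircle_coe, ShearProfile.D_apply, deriv_wprof]
  exact slopeWave_eq_one hε (le_sixteenth hε') 0 ⟨by push_cast; linarith [ht.1], by push_cast; linarith [ht.2]⟩

/-- **Plateau `−1`**: `Q̃' = −1` at `↑t − ½` for `t ∈ [0, ½ − 2ε]` (i.e. on the arc `[½, 1 − 2ε]`). [ours; elementary] -/
theorem wprofD_eq_neg_one {t : ℝ} (ht : t ∈ Icc (0 : ℝ) (1 / 2 - 2 * ε)) :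
    (wprof hε hε').D.onCircle ((t : UnitAddCircle) - (((1 : ℝ) / 2 : ℝ) : UnitAddCircle)) = -1 := by
  rw [← AddCircle.coe_sub, ShearProfile.onCircle_coe, ShearProfile.D_apply, deriv_wprof]
  exact slopeWave_eq_neg_one hε (-1) ⟨by push_cast; linarith [ht.1], by push_cast; linarith [ht.2]⟩

/-- **`Q̃' = 1` on the arc `inArc (2δ)`** when `2ε ≤ 2δ`. [ours; elementary] -/
theorem wprofD_eq_one_of_inArc {δ : ℝ} (hδε : ε ≤ δ) {y : UnitAddCircle} (hy : inArc (2 * δ) y) :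
    (wprof hε hε').D.onCircle y = 1 := by
  obtain ⟨t, ht, rfl⟩ := hy
  have hδ0 : 0 ≤ δ := hε.le.trans hδε
  exact wprofD_eq_one hε hε' ⟨by linarith [ht.1], by linarith [ht.2]⟩

/-- **`Q̃' = −1` where `y + ½ ∈ inArc (2δ)`** when `ε ≤ δ`. [ours; elementary] -/
theorem wprofD_eq_neg_one_of_inArc {δ : ℝ} (hδε : ε ≤ δ) {y : UnitAddCircle}
    (hy : inArc (2 * δ) (y + (((1 : ℝ) / 2 : ℝ) : UnitAddCircle))) : (wprof hε hε').D.onCircle y = -1 := by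
  obtain ⟨t, ht, ht'⟩ := hy
  have hδ0 : 0 ≤ δ := hε.le.trans hδε
  have hy' : y = (t : UnitAddCircle) - (((1 : ℝ) / 2 : ℝ) : UnitAddCircle) := by
    rw [ht']; abel
  rw [hy']
  exact wprofD_eq_neg_one hε hε' ⟨by linarith [ht.1], by linarith [ht.2]⟩

/-- **`∫₀¹ Q̃' = 0`** (the slope wave has zero mean). [folklore] -/
theorem intervalIntegral_deriv_wprof : ∫ t in (0 : ℝ)..1, deriv (wprof hε hε') t = 0 := by
  simp_rw [deriv_wprof hε hε']
  rw [intervalIntegral.integral_comp_add_right (fun t => DEIJ.slopeWave ε t), zero_add]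
  have h := (DEIJ.slopeWave_periodic ε).intervalIntegral_add_eq (2 * ε - 4⁻¹) 0
  rw [zero_add, DEIJ.intervalIntegral_slopeWave hε (le_sixteenth hε')] at h
  rw [show (1 : ℝ) + (2 * ε - 4⁻¹) = (2 * ε - 4⁻¹) + 1 by ring, h]

/-- `∫₀¹ Q̃'² ≤ 1`. [folklore] -/
theorem msqD_wprof_le : msqD (wprof hε hε') ≤ 1 := by
  unfold msqD
  have hc : Continuous fun t => deriv (wprof hε hε') t ^ 2 := by
    simp_rw [deriv_wprof hε hε']
    exact ((DEIJ.continuous_slopeWave hε (le_sixteenth hε')).comp (continuous_id.add continuous_const)).pow 2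
  have h1 : ∫ t in (0 : ℝ)..1, deriv (wprof hε hε') t ^ 2 ≤ ∫ _t in (0 : ℝ)..1, (1 : ℝ) := by
    refine intervalIntegral.integral_mono_on zero_le_one (hc.intervalIntegrable 0 1) intervalIntegrable_const
      fun t _ => ?_
    have h := abs_deriv_wprof_le hε hε' t
    have := pow_le_pow_left₀ (abs_nonneg _) h 2
    simpa only [sq_abs, one_pow] using this
  simpa using h1

/-- `0 ≤ ∫₀¹ Q̃'²`. [folklore] -/
theorem msqD_nonneg (P : ShearProfile) : 0 ≤ msqD P :=
  intervalIntegral.integral_nonneg zero_le_one fun _ _ => sq_nonneg _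

end Profile

/-! ## 3. The diagonal crossed-shear flow `V₂` and its gradient -/

section Flow

variable (κ : ℝ) (Q : ShearProfile)

/-- The shear directions `τ_A = (0,1,−1)`, `τ_B = (0,1,1)`. [ours; bookkeeping] -/
def tauA : EuclideanSpace ℝ (Fin 3) := EuclideanSpace.single 1 (1 : ℝ) - EuclideanSpace.single 2 (1 : ℝ)
/-- The shear direction `τ_B = (0,1,1)`. [ours; bookkeeping] -/
def tauB : EuclideanSpace ℝ (Fin 3) := EuclideanSpace.single 1 (1 : ℝ) + EuclideanSpace.single 2 (1 : ℝ)

/-- Components of `τ_A`. [folklore] -/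
@[simp] theorem tauA_apply (i : Fin 3) : tauA i = if i = 1 then 1 else if i = 2 then -1 else 0 := by
  fin_cases i <;> simp [tauA]
/-- Components of `τ_B`. [folklore] -/
@[simp] theorem tauB_apply (i : Fin 3) : tauB i = if i = 1 then 1 else if i = 2 then 1 else 0 := by
  fin_cases i <;> simp [tauB]

/-- **The diagonal crossed-shear flow** `V₂(x) = κQ(x₁+x₂)·τ_A + κQ(x₁−x₂)·τ_B`. [ours] -/
def V2 (κ : ℝ) (Q : ShearProfile) (x : UnitAddTorus (Fin 3)) : EuclideanSpace ℝ (Fin 3) :=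
  (κ * diagForm 1 1 Q x) • tauA + (κ * diagForm 1 (-1) Q x) • tauB

/-- `V₂` is smooth. [ours; elementary] -/
theorem isSmooth_V2 : IsSmooth (V2 κ Q) :=
  (((isSmooth_diagForm 1 1 Q).smul κ).smul' (isSmooth_const _)).add
    (((isSmooth_diagForm 1 (-1) Q).smul κ).smul' (isSmooth_const _))

/-- `C¹` bookkeeping. [folklore] -/
theorem isContDiff_V2 : IsContDiff 1 (V2 κ Q) := (isSmooth_V2 κ Q).isContDiff (by simp)

/-- `C¹` products (bookkeeping on `T³`). [folklore] -/
theorem isContDiff_smul_const₃ {a : UnitAddTorus (Fin 3) → ℝ} (ha : IsContDiff 1 a)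
    (v : EuclideanSpace ℝ (Fin 3)) : IsContDiff 1 (fun y => a y • v) :=
  ContDiff.smul ha (isContDiff_const (d := Fin 3) (n := 1) v)

/-- Partial derivatives of constants vanish (on `T³`). [folklore] -/
theorem partialDeriv_const_eq_zero₃ {F : Type*} [NormedAddCommGroup F] [NormedSpace ℝ F] (c : F)
    (r : Fin 3) (y : UnitAddTorus (Fin 3)) : Torus.partialDeriv r (fun _ : UnitAddTorus (Fin 3) => c) y = 0 := by
  unfold Torus.partialDeriv Torus.lineDeriv; simp

/-- **`∂_j V₂ = κ n_{A,j} Q'(x₁+x₂) τ_A + κ n_{B,j} Q'(x₁−x₂) τ_B`**, `n_A = (0,1,1)`, `n_B = (0,1,−1)`. [ours; elementary] -/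
theorem partialDeriv_V2 (j : Fin 3) (x : UnitAddTorus (Fin 3)) :
    Torus.partialDeriv j (V2 κ Q) x =
      (κ * (diagCoeff 1 1 j * (Q.D.onCircle (x 1 + x 2)))) • tauA +
        (κ * (diagCoeff 1 (-1) j * (Q.D.onCircle (x 1 - x 2)))) • tauB := by
  have hc1 : IsContDiff 1 (fun y : UnitAddTorus (Fin 3) => κ * diagForm 1 1 Q y) :=
    (isContDiff_diagForm 1 1 Q).smul κ
  have hc2 : IsContDiff 1 (fun y : UnitAddTorus (Fin 3) => κ * diagForm 1 (-1) Q y) :=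
    (isContDiff_diagForm 1 (-1) Q).smul κ
  have e : V2 κ Q = (fun y => (κ * diagForm 1 1 Q y) • tauA) + fun y => (κ * diagForm 1 (-1) Q y) • tauB := rfl
  rw [e, partialDeriv_add (isContDiff_smul_const₃ hc1 _) (isContDiff_smul_const₃ hc2 _), Pi.add_apply,
    partialDeriv_smul hc1 (isContDiff_const _), partialDeriv_smul hc2 (isContDiff_const _),
    partialDeriv_const_eq_zero₃, partialDeriv_const_eq_zero₃]
  have h1 : Torus.partialDeriv j (fun y : UnitAddTorus (Fin 3) => κ * diagForm 1 1 Q y) x =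
      κ * (diagCoeff 1 1 j * Q.D.onCircle (x 1 + x 2)) := by
    have e1 : (fun y : UnitAddTorus (Fin 3) => κ * diagForm 1 1 Q y) = fun y => κ • diagForm 1 1 Q y := rfl
    rw [e1, partialDeriv_smul (isContDiff_const _) (isContDiff_diagForm 1 1 Q), partialDeriv_const_eq_zero₃,
      partialDeriv_diagForm]
    simp
  have h2 : Torus.partialDeriv j (fun y : UnitAddTorus (Fin 3) => κ * diagForm 1 (-1) Q y) x =
      κ * (diagCoeff 1 (-1) j * Q.D.onCircle (x 1 - x 2)) := by
    have e1 : (fun y : UnitAddTorus (Fin 3) => κ * diagForm 1 (-1) Q y) = fun y => κ • diagForm 1 (-1) Q y := rfl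
    rw [e1, partialDeriv_smul (isContDiff_const _) (isContDiff_diagForm 1 (-1) Q), partialDeriv_const_eq_zero₃,
      partialDeriv_diagForm]
    simp
  rw [h1, h2]; simp

/-- **Components of `∂_j V₂`**: with `a = Q'(x₁+x₂)`, `b = Q'(x₁−x₂)`:
`∂₀V₂ = 0`, `∂₁V₂ = κ(0, a+b, b−a)`, `∂₂V₂ = κ(0, a−b, −a−b)`. [ours; elementary] -/
theorem partialDeriv_V2_apply (j i : Fin 3) (x : UnitAddTorus (Fin 3)) :
    Torus.partialDeriv j (V2 κ Q) x i =
      κ * (diagCoeff 1 1 j * Q.D.onCircle (x 1 + x 2)) * (if i = 1 then 1 else if i = 2 then -1 else 0) +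
        κ * (diagCoeff 1 (-1) j * Q.D.onCircle (x 1 - x 2)) * (if i = 1 then 1 else if i = 2 then 1 else 0) := by
  rw [partialDeriv_V2]
  simp [smul_eq_mul]

/-- **`V₂` is divergence free** (`τ_A ⊥ n_A`, `τ_B ⊥ n_B`). [ours; elementary] -/
theorem isDivFree_V2 : IsDivFree (V2 κ Q) := by
  intro x
  unfold Torus.divergence
  have hcomp : ∀ i : Fin 3, (fun y => V2 κ Q y i) =
      fun y => (κ * (if i = 1 then (1:ℝ) else if i = 2 then -1 else 0)) * diagForm 1 1 Q y +
        (κ * (if i = 1 then (1:ℝ) else if i = 2 then 1 else 0)) * diagForm 1 (-1) Q y := by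
    intro i; funext y; simp [V2, smul_eq_mul]
  have hderiv : ∀ i j : Fin 3, Torus.partialDeriv j (fun y => V2 κ Q y i) x =
      (κ * (if i = 1 then (1:ℝ) else if i = 2 then -1 else 0)) * (diagCoeff 1 1 j * diagForm 1 1 Q.D x) +
        (κ * (if i = 1 then (1:ℝ) else if i = 2 then 1 else 0)) * (diagCoeff 1 (-1) j * diagForm 1 (-1) Q.D x) := by
    intro i j
    rw [hcomp i]
    have ha : IsContDiff 1 (fun y : UnitAddTorus (Fin 3) =>
        (κ * (if i = 1 then (1:ℝ) else if i = 2 then -1 else 0)) * diagForm 1 1 Q y) :=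
      (isContDiff_diagForm 1 1 Q).smul _
    have hb : IsContDiff 1 (fun y : UnitAddTorus (Fin 3) =>
        (κ * (if i = 1 then (1:ℝ) else if i = 2 then 1 else 0)) * diagForm 1 (-1) Q y) :=
      (isContDiff_diagForm 1 (-1) Q).smul _
    rw [show (fun y => (κ * (if i = 1 then (1:ℝ) else if i = 2 then -1 else 0)) * diagForm 1 1 Q y +
        (κ * (if i = 1 then (1:ℝ) else if i = 2 then 1 else 0)) * diagForm 1 (-1) Q y) =
        (fun y => (κ * (if i = 1 then (1:ℝ) else if i = 2 then -1 else 0)) * diagForm 1 1 Q y) +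
        fun y => (κ * (if i = 1 then (1:ℝ) else if i = 2 then 1 else 0)) * diagForm 1 (-1) Q y from rfl,
      partialDeriv_add ha hb, Pi.add_apply]
    have e1 : (fun y : UnitAddTorus (Fin 3) => (κ * (if i = 1 then (1:ℝ) else if i = 2 then -1 else 0)) *
        diagForm 1 1 Q y) = fun y => (κ * (if i = 1 then (1:ℝ) else if i = 2 then -1 else 0)) • diagForm 1 1 Q y := rfl
    have e2 : (fun y : UnitAddTorus (Fin 3) => (κ * (if i = 1 then (1:ℝ) else if i = 2 then 1 else 0)) *
        diagForm 1 (-1) Q y) = fun y => (κ * (if i = 1 then (1:ℝ) else if i = 2 then 1 else 0)) • diagForm 1 (-1) Q y := rfl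
    rw [e1, e2, partialDeriv_smul (isContDiff_const _) (isContDiff_diagForm 1 1 Q),
      partialDeriv_smul (isContDiff_const _) (isContDiff_diagForm 1 (-1) Q), partialDeriv_const_eq_zero₃,
      partialDeriv_const_eq_zero₃, partialDeriv_diagForm, partialDeriv_diagForm]
    simp [smul_eq_mul]
  simp only [hderiv, Fin.sum_univ_three, diagCoeff]
  simp
  ring

end Flow

end WrapStretching

end Summit.NavierStokesRegularity.FunctionalMining

end
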